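import Mathlib
import HarnessLib
import HarnessLib.Audit
import Summits.KontsevichZagierPeriods.Statement
import Literature.NumberTheory.Transcendental.KZCalculusProofs
import HarnessLib.Audit.Status.Attr

/-!
Route: MellinCoarea

# Route MellinCoarea — Conjecture 1 in families — coarea turns exponent identities into fibrewise
1-period transfer; Gauss triplication for all s is one 3-isogeny in the Γ₀(3) pencil

X = FIBREWISE TRANSFER (card mellin-coupling-pushforward, its step (E3) promoted to a principle):
Conjecture 1 IN FAMILIES —
if two ℚ-semialgebraic integral representations of the same total dimension b + k, read as families
over the first b coordinates,
have almost-everywhere equal FIBRE integrals (over the last k coordinates), then they are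
KZ-equivalent as total representations.
X is an honest reformulation, not a strengthening: X → summit by constant families (b = 0; PROVED as
the route's deciding theorem
`closes : FibrewiseTransfer → KontsevichZagierPeriods`, rev 1 — the Assembly item's statement) and
summit → X by Fubini +
soundness (support SummitImpliesTransfer, stated over the summit decl itself since rev 1). Its point
is the new FILTRATION BY FIBRE DIMENSION k: k = 0 is one change of variables per
monotonicity cell (support DuplicationFamily = Legendre duplication at every rational exponent); k =
1 is "1-periods, absolute and
in families" (crux RelTransferOne), the only stratum whose transcendence input is a THEOREM on both
sides (Huber–Wüstholz for
constants, Ayoub / Bakker–Tsimerman functional transcendence along the base); and the card's coarea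
move lowers k by one for every
identity that holds identically in a rational EXPONENT s (Mellin uniqueness ⇒ equality of
pushforward measures ⇒ fibrewise equality of
level densities), so that Gauss triplication at ALL rational s — a 2-dimensional CM/Fermat identity,
pair 0312's whole family —
lands in k = 1 as ONE identity of elliptic pencils over ℚ(u) (cruxes TriplicationFibreTransfer,
MultiplicationThree).
Lean: `∀ ⦃b k : ℕ⦄ (r r' : Literature.NumberTheory.Transcendental.KZ.IntegralRep (b + k)), (∀ᵐ x :
(Fin b → ℝ), (∫ y in {y : Fin k → ℝ | Fin.append x y ∈ r.domain}, r.integrand (Fin.append x y)) = ∫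
y in {y : Fin k → ℝ | Fin.append x y ∈ r'.domain}, r'.integrand (Fin.append x y)) →
Literature.NumberTheory.Transcendental.KZ.Equivalent r r'`

## Assembly
Constant families: given KZ-rational r (dim n), r′ (dim m) with equal values, lift both by slabs to
dimension 0 + max n m
(KZCalculusProofs `IntegralRep.exists_equivalent_of_le`, values kept by
`Equivalent.value_eq_holds`), apply FibrewiseTransfer with b = 0,
k = max n m — the a.e. hypothesis over Fin 0 → ℝ (a Dirac mass) is the single equality of values
after the volume-preserving
reindexing y ↦ Fin.append x y — and compose equivalences (Equivalent.trans/symm). PROVED (rev 1):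
this is `theorem closes` at the
end of the route file (35 lines; Fin.append_left_nil + MeasurableEquiv.piCongrLeft (finCongr
(Nat.zero_add k)) make the one-point-base
fibre integral the value; import Literature.NumberTheory.Transcendental.KZCalculusProofs for the
slabs). The cruxes are the strata
k = 1 (RelTransferOne) and its coarea-fed instance (TriplicationFibreTransfer ↔
MultiplicationThree); they do not enter the Assembly
term, exactly as in route LowDimension.

Rationale: WHY THIS LINE. An identity holding for every rational exponent s, [σ, F^s g] = [σ′, F′^s g′], is not
a semialgebraic family (s sits in the exponent), and every printed proof of the flagship one, Gauss
multiplication, leaves the algebraic class (Γ and e^{−t}, AndrewsAskeyRoy1999 §1.5; Bohr–Mollerup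
interpolation, the tree's GaussMultiplicationFormula_holds; identities in law proved by Mellin
transforms, Dufresne2010, ChaumontYor2003). The dictionary of the card is exact and classical:
E[X^s] = ∫ u^s ρ(u) du is the Mellin transform of the Gelfand–Leray function ρ(u) = ∫_{F=u} g dx/dF
(ArnoldGuseinzadeVarchenko2012 §7.1 Lemma 7.2, §7.2.2), so "equal for all s" ⟺ ρ ≡ ρ′, and the
coarea shear (x̂, x_n) ↦ (x̂, F) that produces ρ IS rule (2) on each cell where ∂F/∂x_n keeps a sign
(support CoareaShear) — no variable is integrated out, no primitive is asked for. What remains is a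
statement ONE FIBRE DIMENSION DOWN and uniform in the level u: fibrewise-equal families are
uniformly equivalent (RelTransferOne), i.e. Conjecture 1 in families, whose k = 1 stratum imports
1-motive transcendence (HuberWustholz2022) for the isotrivial directions and functional
transcendence / relative period conjectures (Ayoub2015, AyoubRelKZRevisited, BakkerTsimerman2025,
Andre1989) along the base, plus the finite-correspondence engine of route MultivaluedCoV
(SheetTransfer) to turn isogenies into moves. Worked to the end for n = 3 (planner's hand
computation, this session): after coarea the simplex side of MultiplicationThree is the elliptic
pencil E_u : w² = a²(3−a)² − 4ua with j(E_u) = 27(9−8u)³/(u³(1−u)) = j(3τ) at the cubic modulus x =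
u of Ramanujan's signature-3 theory (BerndtBhargavaGarvan1995 (2.12), Lemma 5.1;
BorweinBorwein1991), and BOTH level densities equal (2π/√3)·₂F₁(⅓,⅔;1;1−u) (Euler integral + Pfaff
on the box side; matching endpoint constant B(⅓,⅔) and matching log-coefficient 1 at u → 0 on the
simplex side): Gauss triplication at every rational s becomes one isogeny-type correspondence in the
Γ₀(3) elliptic pencil (a 3-isogeny on the simplex side's j), to be transported into the rules
uniformly in u — a different and d-free witness from Terasoma's degree-d covering (Terasoma1995,
OtsuboYamazaki2026 Thm 7.2 / Rem 7.4, route TerasomaCovering, with which the sector target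
MultiplicationThree is SHARED verbatim) and from the degree-9 Fermat surface of Neg 0311
(Deligne1982HodgeCycles §7).

RANKED CRUXES. #0 FibrewiseTransfer (target) — Conjecture 1 in families: for all b, k and all
representations r, r′ of dimension b + k, almost-everywhere equality (in the base point x ∈ ℝ^b) of
the fibre integrals ∫_{y : (x,y) ∈ domain} integrand(x,y) dy implies KZ.Equivalent r r′. Equivalent
to the summit (Assembly + SummitImpliesTransfer); filtered by k it is the route. (why it might fail:
b = 0 is the summit in its semialgebraic form (all GPC-strength barriers); k ≥ 2 strata contain
ζ(2), polylog and elliptic-surface identities with no mechanism here.) [KontsevichZagier2001,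
Ayoub2015, HuberMullerStach2017, ArnoldGuseinzadeVarchenko2012]
#2 RelTransferOne (crux) — the k = 1 stratum (card item N4 made general): two representations of
dimension b + 1 whose fibre integrals over the LAST coordinate agree for almost every base point x ∈
ℝ^b are KZ-equivalent. b = 0 is Conjecture 1 for all 1-dimensional algebraic representations
(incomplete abelian integrals of every genus: Huber–Wüstholz territory, LowDimension 0117); b ≥ 1 is
its version in families over a semialgebraic base, where the fibrewise identity ρ ≡ ρ′ between
abelian-integral families is a functional identity and the expected witness is a correspondence over
ℚ(base) acting by sheetwise changes of variables uniformly in the base (MultivaluedCoV.SheetTransfer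
in families) plus Newton–Leibniz for exact corrections. A fibre-constant semialgebraic weight w(x)
rides along for free (apply the statement to w·r, w·r′), which is how u^{s−1} is carried.
[difficulty: open-problem] (why it might fail: b = 0 needs Huber–Wüstholz for ALL 1-motives plus a
rules transfer nobody has written; for b ≥ 1 the correspondence behind ρ ≡ ρ′ may exist only after a
ramified base change (u ↦ u^{1/3}) or over ℚ(u,√−3), or need u-dependent second-kind corrections
with non-semialgebraic primitives.) [HuberWustholz2022, BakkerTsimerman2025, Ayoub2015,
AyoubRelKZRevisited, Andre1989, KontsevichZagier2001]
#3 TriplicationFibreTransfer (crux) — the n = 3 multiplication family AFTER coarea, for every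
rational s > 0, base u = z 0 ∈ (0,1) first and fibre last: [Σ_simp, 2u^{s−1}/√(a²(3−a)²−4ua)] ~
[Σ_box, u^{s−1} v^{−2/3}(1−v)^{−2/3}(1−u−v)^{−1/3}], Σ_simp = {0 < a < 3, 0 < u, 4u < a(3−a)²}
(pushforward of Lebesgue on the simplex under σ₁σ₂(3−σ₁−σ₂), two cells), Σ_box = {0 < u, 0 < v, u +
v < 1} (pushforward of v₁^{−2/3}v₂^{−1/3}dv under (1−v₁)(1−v₂), one cell). Fibre integrals:
u^{s−1}ρ(u) on both sides with ρ(u) = (2π/√3)·₂F₁(⅓,⅔;1;1−u); the simplex fibre is the real period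
of E_u : w² = a²(3−a)² − 4ua, j(E_u) = 27(9−8u)³/(u³(1−u)) = j(3τ) at cubic modulus x = u; the box
fibre is Ramanujan's cubic period on the ℤ/3-curve w³ = v²(1−v)²(1−u−v) (genus 2, ℤ[ζ₃]-action of
signature (1,1), so its Jacobian should be isogenous to the square of an elliptic curve — expected
in the same Γ₀(3) class since the two period functions coincide; the falsifier's point count decides
over which field). To prove: realise that isogeny/correspondence by finitely many real semialgebraic
sheets over Σ (maps (u, a) ↦ (u, φ_k(u, a)), base-preserving so u^{s−1} is untouched), i.e. an
instance of RelTransferOne's conclusion exhibited by hand. Checked at s = 1: both fibred values 9/2.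
[deps: RelTransferOne] [difficulty: L] (why it might fail: the square-root pencil and the cube-root
pencil meet only through an isogeny defined over ℚ(u,√−3) (complex sheets ⇒ (Re,Im) splittings) or
after u ↦ u³; real sheets may need Pochhammer-type boundary chains at the moving branch points
a₁(u), a₂(u), 1−u.) [BerndtBhargavaGarvan1995, BorweinBorwein1991, ArnoldGuseinzadeVarchenko2012,
Terasoma1995, OtsuboYamazaki2026, KontsevichZagier2001]
#4 MultiplicationThree (crux) — SHARED verbatim with route TerasomaCovering
(stmt-KontsevichZagierPeriods-3598): for every rational s > 0 the box representation of B(⅓,s)B(⅔,s)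
on (0,1)² and the simplex representation ∫∫_{σ₁,σ₂>0, σ₁+σ₂<3}(σ₁σ₂(3−σ₁−σ₂))^{s−1} (value
3^{3s−1}Γ(s)³/Γ(3s)) are KZ-equivalent — Gauss triplication at all rational arguments at once; by
TerasomaCovering.TriplicationGlue it yields the tree's test pair 0312 (Neg's bet 0311 dies). Reached
HERE from TriplicationFibreTransfer by two coarea shears per side (support TriplicationCoareaGlue,
an iff), THERE by Terasoma's Betti transposition: two mechanisms, one decl. [deps:
TriplicationFibreTransfer] [difficulty: L] (why it might fail: every printed proof leaves the
algebraic class (Γ, e^{−t}, interpolation from integers); in the rules only N·([r]−[r′]) may be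
reachable if FormalRep/relations has torsion; a chain uniform in s may not exist even if each s has
one.) [Terasoma1995, OtsuboYamazaki2026, AndrewsAskeyRoy1999, Deligne1982HodgeCycles,
KontsevichZagier2001]
#9 CoareaShear (support) — the coarea move is ONE instance of rule (2): for F ℚ-semialgebraic on
r.domain ⊂ ℝ^{n+1} with a derivative F′ within the domain and Φ(x) = (init x, F x) injective there,
if r′.domain = Φ(r.domain) and r.integrand x = r′.integrand (Φ x)·|∂F/∂x_n(x)|, then [r] − [r′] ∈
changeOfVariablesRel (det Φ′ = ∂F/∂x_n, block-triangular). The same shear as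
ScissorsTransport.NewtonLeibnizElimination with F the level function instead of the primitive; used
twice per side in TriplicationCoareaGlue. [difficulty: provable-now] [KontsevichZagier2001,
ArnoldGuseinzadeVarchenko2012, BochnakCosteRoy1998]
#9 TriplicationCoareaGlue (support) — the fibred n = 3 statement and the box/simplex statement are
equivalent inside the rules: simplex side = domain additivity at σ₂ = (3−σ₁)/2 (null line) +
CoareaShear on the two monotonicity cells of σ₂ ↦ σ₁σ₂(3−σ₁−σ₂) (both land on [Σ_simp,
u^{s−1}/√(a²(3−a)²−4ua)]) + integrand additivity (factor 2) + the coordinate swap (u first); box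
side = one CoareaShear along v₂ for (1−v₁)(1−v₂) (|∂| = 1−v₁, image Σ_box) + swap. Radicals
explicit; side conditions (InjOn, HasFDerivWithinAt, semialgebraic images) routine. [difficulty: M]
[KontsevichZagier2001, ArnoldGuseinzadeVarchenko2012]
#9 DuplicationFamily (support) — SHARED verbatim with route CubicTransport
(stmt-KontsevichZagierPeriods-3727): B(a,a) = 2^{1−2a}B(½,a) for every rational a > 0 as a
KZ-equivalence of 1-dimensional representations — the k = 0 stratum of this route (the pushforward
of dx under x(1−x) has the SEMIALGEBRAIC density 2/√(1−4u): one CoV per cell, nothing fibrewise),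
containing LowDimension 0118 (a = ⅓) and the card's item N5. [difficulty: provable-now]
[KontsevichZagier2001, AndrewsAskeyRoy1999, Waldschmidt2006]
#9 SummitImpliesTransfer (support) — the semialgebraic form of the summit (KZPeriodConjecture′,
proved equivalent to KontsevichZagierPeriods in tree) implies FibrewiseTransfer: a.e.-equal fibre
integrals give equal values by Fubini along Fin.append (KZProduct.appendMeasurableEquiv is
volume-preserving). Certifies that X is a reformulation, not a strengthening. [difficulty:
provable-now] [KontsevichZagier2001, HuberMullerStach2017]

TWO-LAYER PLAN. Foreseen, none filed now (D-0019): RelTransferOne ⇐ RelTransferOneIsotrivial (b = 0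
and base-constant directions: Huber–Wüstholz
transfer, jointly with LowDimension 0117/0510) → RelTransferOneGeneric (ρ ≡ ρ′ along a
non-isotrivial base ⇒ a correspondence over a
finite cover of ℚ(base), by functional transcendence BakkerTsimerman2025 / Ayoub, realised by
SheetTransfer in families) → RelTransferOne.
TriplicationFibreTransfer ⇐ IsogenySheetsU (the explicit correspondence between E_u and the
ℤ/3-pencil as ≤ 3 real semialgebraic
sheets over Σ_box, base-preserving) → SheetChainU (sheets + exact corrections are moves uniformly in
u; the u^{s−1} weight rides along)
→ TriplicationFibreTransfer. After MultiplicationThree closes: composite n = 2^a·3^b by products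
(KZProductIdeal
mul_mem_relations_left_holds, proved) at shifted arguments; prime n ≥ 5 has fibre dimension n − 2 ≥
3 and is NOT claimed.

KILL CRITERIA. Every item here is implied by the semialgebraic form of the summit
(KZPeriodConjecture′ ⟺ KontsevichZagierPeriods, proved in
tree), so a REFUTATION of RelTransferOne, TriplicationFibreTransfer or MultiplicationThree is a
refutation of the summit: hand the
invariant to route Neg and close this route `refuted:<Decl>` the same day. The line is closed
`superseded --by
route-KontsevichZagierPeriods-TerasomaCovering` if MultiplicationThree is proved there AND two
prover seats on TriplicationFibreTransfer
file censuses saying the isogeny needs complex sheets with no real semialgebraic descent (then the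
level transport adds nothing to
the sector); it goes dormant-positive if MultiplicationThree and TriplicationFibreTransfer both
close while RelTransferOne shows no
movement beyond b = 0. A proof of the Assembly + SummitImpliesTransfer is expected early and is NOT
progress on the summit.

NOT DECOMPOSED YET. The general GLUING lemma (a semialgebraic family of move instances over a base
is a move instance on the total space, after
discarding a null set where joint differentiability fails) — prover-level, `--supports
RelTransferOne`; the ANCHOR step of the card
(ρ ≡ ρ′ ⟸ common Picard–Fuchs annihilator + finitely many INTEGER moments = rational identities;
BostanLairezSalvy2013, Lairez2015)
— needed only to USE RelTransferOne analytically, never to exhibit a chain, so not an item; the k ≥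
2 strata; prime n ≥ 5
multiplication (fibre dimension n − 2); the b = 0 piece of RelTransferOne (left with LowDimension);
products/Dirichlet re-association
to the literal pair 0312 (TerasomaCovering.TriplicationGlue, FermatIsogeny.DirichletNinth already
filed there).

CHEAPEST FALSIFIER. RUN BY HAND this session (NOTES.md; script falsifier/main.py in the planner
folder, unexecuted: compute socket absent): the
binary-quartic invariants of Q(a) = a⁴ − 6a³ + 9a² − 4ua are I = 9(9−8u), J = −54(8u²−36u+27), 4I³ −
J² = 2916·64·u³(1−u), so
j(E_u) = 6912 I³/(4I³−J²) = 27(9−8u)³/(u³(1−u)); with t = (η(τ)/η(3τ))¹², x = 27/(t+27)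
(BerndtBhargavaGarvan1995 Lemma 5.1) and
j(3τ) = (t+27)(t+3)³/t one gets j(3τ) = 27(9−8x)³/(x³(1−x)) — EQUAL at x = u: the simplex pencil is
3-isogenous over ℂ(u) to the
signature-3 curve with period ₂F₁(⅓,⅔;1;1−u); a non-modular j(E_u) would have killed the isogeny
witness. Also ρ_box =
B(⅓,⅔)·₂F₁(⅓,⅔;1;1−u) exactly (Euler + Pfaff), ρ_simp(1⁻) = 2π/√3 = B(⅓,⅔), log-coefficient 1 at u →
0 on both sides. NEXT
(refuter, 10 min CAS): run falsifier/main.py (ρ_simp = ρ_box at six points; four integer moments vs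
3^{3s−1}Γ(s)³/Γ(3s) =
B(⅓,s)B(⅔,s)), then count points on w³ = v²(1−v)²(1−u−v) over 𝔽_p, p ≡ 1 (3): Jacobian 𝔽_p-isogenous
to E_u² or only to a cubic
twist? The twist case is the "complex sheets" branch of TriplicationFibreTransfer's
why-it-might-fail, not a kill.

NUMBERS. ρ(u) = (2π/√3)·₂F₁(⅓,⅔;1;1−u) on (0,1); ρ(1⁻) = 2π/√3 = B(⅓,⅔) = 3.6275987…; fibred and
unfibred values at s = 1: 9/2 on all
four sides; MultiplicationThree at s = 1/9: 111.09287484 (TerasomaCovering); j(E_u) =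
27(9−8u)³/(u³(1−u)), singular fibres
u = 0, 1, ∞; Hesse/cubic inversion ₂F₁(⅓,⅔;1;x) = a(q) (BerndtBhargavaGarvan1995 (2.12)). Items at
open: 9 (1 target, 3 cruxes,
4 support, 1 assembly); 2 of them shared verbatim with TerasomaCovering (3598) and CubicTransport
(3727).

DEFINITION REQUESTS. None: all nine statements elaborate over KZCalculus / PeriodConjecture /
Mathlib (folder Sketch.lean rc 0). No cite facts needed as
hypotheses (GaussMultiplicationFormula_holds, mul_mem_relations_left_holds,
kzPeriodConjecture'_iff_isRational are proved in tree).

Novelty: Searches (2026-08-15): `lit search --hybrid "Gauss multiplication formula gamma function proof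
multiple integral change of variables beta integrals"` (10 held books: AAR 1999, Chaumont–Yor 2003 —
Γ/e^{−t} or Mellin proofs only); `lit search --hybrid "Ramanujan … signature 3 cubic hypergeometric
… j-invariant"` (10; bustoz2001 pp. 59–64 read = Berndt's survey quoting BerndtBhargavaGarvan1995
(2.8)–(2.13)); `lit search --hybrid "Gelfand-Leray form …"` (8; ArnoldGuseinzadeVarchenko2012 pp.
181–183 read: Lemma 7.1–7.2, §7.2.2 Mellin transform of the Gelfand–Leray function); `lit search
--source crossref "probabilistic proof multiplication formula gamma … identities in law"` (12:
Aycock 2021 Euleriana, MacRobert 1959, Chhaibi EJP 2015 — none rules-level); `lit search --source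
zbmath "Gauss multiplication formula beta integrals proof"` (1, irrelevant); `lit galaxy search
"Gelfand-Leray function" --star pdf` (5: Lin's thesis on singular learning theory, Kamimoto–Nose
oscillatory integrals — same Mellin/pushforward analytics, no periods); two `lit galaxy search
--star all` attempts saturated (queued > 90 s); `lit frontier KontsevichZagierPeriods --since 2021`
(30, none on families/coarea); `lit bridges --cross any` (30, none); `lit read arxiv:2402.06072`
§7.2 (OtsuboYamazaki2026 Thm 7.2, Rem 7.4 read); in-tree: all Theses of the sub incl. today's
TerasomaCovering, FermatIsogeny, CubicTransport, MultivaluedCoV, MellinExponentDeformation,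
LiftingCriteria, GaussManinCertificates; `ledge  [refs: 2402.06072, arxiv:2402.06072, BerndtBhargavaGarvan1995, ArnoldGuseinzadeVarchenko2012, OtsuboYamazaki2026, Terasoma1995, Dufresne2010, ChaumontYor2003, Ayoub2015, BorweinBorwein1991]

Barriers (technique_class: coarea-pushforward fibrewise-transfer isogeny-transport): - technique_class: coarea-pushforward fibrewise-transfer isogeny-transport
- Literature.Barriers.KontsevichZagierPeriods.noSemialgebraicPrimitive_inv_sub_two: EVADED — the
barrier kills "integrate a variable out with an admissible primitive"; here the level u is
INTRODUCED as a coordinate by rule (2) (CoareaShear, Jacobian |∂F/∂x_n|), nothing is integrated out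
and no primitive is requested; fibrewise transfer asks for chains uniform in the base, and its toy
cases with transcendental fibrewise primitives (f = 1/(t−2−x) + 1/(t+1+x), ∫ dt ≡ 0) are two changes
of variables, exactly the barrier's own scope caveat.
- Literature.Barriers.KontsevichZagierPeriods.kzConjecture_implies_oddZetaAlgIndep: it does not
evade it — the target X is equivalent to the summit, so X and the Assembly direction carry full GPC
strength; the bet is structural: the filtration isolates k ≤ 1, where the transcendence input is a
theorem (HuberWustholz2022 for constants, BakkerTsimerman2025 / Ayoub2015 for functions) and the
Γ-sector instance is pure CM (motivic by Deligne1982HodgeCycles §7), and the cruxes assert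
derivability, never independence.
- Literature.Barriers.KontsevichZagierPeriods.kzConjecture_implies_twoPiI_log_algIndep: same status
as the odd-zeta barrier (applies to X as a whole; the k = 1 cruxes touch logarithms only through
Baker/Huber–Wüstholz-known relations at b = 0).
- Literature.Barriers.KontsevichZagierPeriods.kzConjecture_implies_ellipticPeriods_algIndep: applies
to X; for the cruxes

Novelty grade: new-combination — ROUTE REVIEW (refuter 2026-08-15). Novelty: coarea/Gelfand–Leray pushforward (AGZV §7, classical analysis) recast as KZ rule (2) (CoareaShear) + 'Conjecture 1 in families' filtered by fibre dimension + the Γ₀(3)/signature-3 identification of the n=3 fibre; none found joined in print for the KZ calcu (refuter refuter-rreview-route-ValiantsHypothesis-347721ba-0, 2026-08-15T13:45:18Z; prior: ArnoldGuseinzadeVarchenko2012 (§7.1-7.2 Gelfand-Leray function, Mellin transform), BerndtBhargavaGarvan1995 (signature-3 theory, (2.12), Lemma 5.1), Terasoma1995 / OtsuboYamazaki2026 Thm 7.2 (multiplication formula as period identity, route TerasomaCovering), Ayoub2015 / BakkerTsimerman2025 (functional transcendence along a base), HuberWustholz2022 (1-periods), KontsevichZagier2001 §1.2)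

History (route lifecycle, newest last):
- 2026-08-15T16:18:41Z · rev 1: restated SummitImpliesTransfer (stmt-KontsevichZagierPeriods-5086) — route-repair (glue): deciding theorem closes : FibrewiseTransfer → KontsevichZagierPeriods PROVED (slab padding to dim 0+max n m via KZ.IntegralRep.exists_equiv (planner-rbadge-KontsevichZagierPeriods-MellinC-285615bb-g2-0)
- 2026-08-16T02:18:03Z · AUTO-CRUX: 1 conjecture-grade item(s) promoted to crux (FibrewiseTransfer) — refuter vetting / tiering apply (operator:999:1362873)
- 2026-08-16T04:09:10Z · AUTO-CRUX (backfill): FibrewiseTransfer — hypotheses of the deciding theorem that nothing in the route derives are cruxes (operator:999:1085951)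
- 2026-08-23T19:06:05Z · DORMANT — reconciler: no traction for 6.2 d (last activity item-proof-filed at 2026-08-17T14:22:34Z); parked, not closed — `ledger route dormant route-KontsevichZagierPer (operator:999:826268)
- 2026-08-30T02:50:28Z · REACTIVATED — reconciler: reactivated — activity statement-attached at 2026-08-30T01:45:42Z after parking at 2026-08-23T19:06:05Z (operator:999:1220117)

sub-problem: KontsevichZagierPeriods · status: open · opened planner-plancard-KontsevichZagierPeriods-Kont-e405d973-0 2026-08-15T11:39:47Z · rev 3 · ledger route-KontsevichZagierPeriods-MellinCoarea
GENERATED by the gate from the ledger (D-0016/17). Provers cite these decls: `theorem foo : Summit.KontsevichZagierPeriods.KontsevichZagierPeriods.Theses.MellinCoarea.<Decl> := …` in Summits/KontsevichZagierPeriods/KontsevichZagierPeriods/Theorems/<Name>.lean.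
-/

namespace Summit.KontsevichZagierPeriods.KontsevichZagierPeriods.Theses.MellinCoarea

open scoped BigOperators Topology Manifold Classical MeasureTheory ProbabilityTheory Matrix InnerProductSpace ComplexConjugate ContinuousMap
open Filter Set Function TopologicalSpace MeasureTheory

attribute [summit_statement] _root_.KontsevichZagierPeriods

open Literature Periods

/-- item stmt-KontsevichZagierPeriods-5081 · crux (kind.auto-crux: conjecture-grade) · rank 0 · open · by planner
why it might fail: b = 0 is the summit in its semialgebraic form (all GPC-strength barriers); k ≥ 2 strata contain ζ(2), polylog and elliptic-surface identities with no mechanism here.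
sources: KontsevichZagier2001, Ayoub2015, HuberMullerStach2017, ArnoldGuseinzadeVarchenko2012
[target] Conjecture 1 in families: for all b, k and all representations r, r′ of dimension b + k,
almost-everywhere equality (in the base point x ∈ ℝ^b) of the fibre integrals ∫_{y : (x,y) ∈ domain}
integrand(x,y) dy implies KZ.Equivalent r r′. Equivalent to the summit (Assembly +
SummitImpliesTransfer); filtered by k it is the route. -/
@[route_item "route-KontsevichZagierPeriods-MellinCoarea", crux]
def FibrewiseTransfer : Prop :=
  ∀ ⦃b k : ℕ⦄ (r r' : Literature.NumberTheory.Transcendental.KZ.IntegralRep (b + k)), (∀ᵐ x : (Fin b → ℝ), (∫ y in {y : Fin k → ℝ | Fin.append x y ∈ r.domain}, r.integrand (Fin.append x y)) = ∫ y in {y : Fin k → ℝ | Fin.append x y ∈ r'.domain}, r'.integrand (Fin.append x y)) → Literature.NumberTheory.Transcendental.KZ.Equivalent r r'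

/-- item stmt-KontsevichZagierPeriods-5082 · aside · rank 2 · open · by planner
why it might fail: b = 0 needs Huber–Wüstholz for ALL 1-motives plus a rules transfer nobody has written; for b ≥ 1 the correspondence behind ρ ≡ ρ′ may exist only after a ramified base change (u ↦ u^{1/3}) or over ℚ(u,√−3), or need u-dependent second-kind corrections with non-semialgebraic primitives.
sources: HuberWustholz2022, BakkerTsimerman2025, Ayoub2015, AyoubRelKZRevisited, Andre1989, KontsevichZagier2001
[crux] the k = 1 stratum (card item N4 made general): two representations of dimension b + 1 whose
fibre integrals over the LAST coordinate agree for almost every base point x ∈ ℝ^b are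
KZ-equivalent. b = 0 is Conjecture 1 for all 1-dimensional algebraic representations (incomplete
abelian integrals of every genus: Huber–Wüstholz territory, LowDimension 0117); b ≥ 1 is its version
in families over a semialgebraic base, where the fibrewise identity ρ ≡ ρ′ between abelian-integral
families is a functional identity and the expected witness is a correspondence over ℚ(base) acting
by sheetwise changes of variables uniformly in the base (MultivaluedCoV.SheetTransfer in families)
plus Newton–Leibniz for exact corrections. A fibre-constant semialgebraic weight w(x) rides along
for free (apply the statement to w·r, w·r′), which is how u^{s−1} is carried. [difficulty:
open-problem] -/
@[route_item "route-KontsevichZagierPeriods-MellinCoarea"]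
def RelTransferOne : Prop :=
  ∀ ⦃b : ℕ⦄ (r r' : Literature.NumberTheory.Transcendental.KZ.IntegralRep (b + 1)), (∀ᵐ x : (Fin b → ℝ), (∫ t in {t : ℝ | (Fin.snoc x t : Fin (b + 1) → ℝ) ∈ r.domain}, r.integrand (Fin.snoc x t)) = ∫ t in {t : ℝ | (Fin.snoc x t : Fin (b + 1) → ℝ) ∈ r'.domain}, r'.integrand (Fin.snoc x t)) → Literature.NumberTheory.Transcendental.KZ.Equivalent r r'

/-- item stmt-KontsevichZagierPeriods-5083 · aside · rank 3 · open · by planner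
why it might fail: the square-root pencil and the cube-root pencil meet only through an isogeny defined over ℚ(u,√−3) (complex sheets ⇒ (Re,Im) splittings) or after u ↦ u³; real sheets may need Pochhammer-type boundary chains at the moving branch points a₁(u), a₂(u), 1−u.
sources: BerndtBhargavaGarvan1995, BorweinBorwein1991, ArnoldGuseinzadeVarchenko2012, Terasoma1995, OtsuboYamazaki2026, KontsevichZagier2001
[crux] the n = 3 multiplication family AFTER coarea, for every rational s > 0, base u = z 0 ∈ (0,1)
first and fibre last: [Σ_simp, 2u^{s−1}/√(a²(3−a)²−4ua)] ~ [Σ_box, u^{s−1}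
v^{−2/3}(1−v)^{−2/3}(1−u−v)^{−1/3}], Σ_simp = {0 < a < 3, 0 < u, 4u < a(3−a)²} (pushforward of
Lebesgue on the simplex under σ₁σ₂(3−σ₁−σ₂), two cells), Σ_box = {0 < u, 0 < v, u + v < 1}
(pushforward of v₁^{−2/3}v₂^{−1/3}dv under (1−v₁)(1−v₂), one cell). Fibre integrals: u^{s−1}ρ(u) on
both sides with ρ(u) = (2π/√3)·₂F₁(⅓,⅔;1;1−u); the simplex fibre is the real period of E_u : w² =
a²(3−a)² − 4ua, j(E_u) = 27(9−8u)³/(u³(1−u)) = j(3τ) at cubic modulus x = u; the box fibre is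
Ramanujan's cubic period on the ℤ/3-curve w³ = v²(1−v)²(1−u−v) (genus 2, ℤ[ζ₃]-action of signature
(1,1), so its Jacobian should be isogenous to the square of an elliptic curve — expected in the same
Γ₀(3) class since the two period functions coincide; the falsifier's point count decides over which
field). To prove: realise that isogeny/correspondence by finitely many real semialgebraic sheets
over Σ (maps (u, a) ↦ (u, φ_k(u, a)), base-preserving so u^{s−1} is untouched), i.e. an instance of
RelTransferOne's conclusion exhibited by hand. Che -/
@[route_item "route-KontsevichZagierPeriods-MellinCoarea"]
def TriplicationFibreTransfer : Prop :=
  ∀ s : ℚ, 0 < s → ∀ (r r' : Literature.NumberTheory.Transcendental.KZ.IntegralRep 2), r.domain = {z | z 1 ∈ Set.Ioo (0:ℝ) 3 ∧ 0 < z 0 ∧ 4 * z 0 < z 1 * (3 - z 1) ^ 2} → Set.EqOn r.integrand (fun z => 2 * (z 0) ^ ((s:ℝ) - 1) / Real.sqrt ((z 1) ^ 2 * (3 - z 1) ^ 2 - 4 * z 0 * z 1)) r.domain → r'.domain = {z | 0 < z 0 ∧ 0 < z 1 ∧ z 0 + z 1 < 1} → Set.EqOn r'.integrand (fun z => (z 0)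 ^ ((s:ℝ) - 1) * (z 1) ^ (-(2:ℝ)/3) * (1 - z 1) ^ (-(2:ℝ)/3) * (1 - z 0 - z 1) ^ (-(1:ℝ)/3)) r'.domain → Literature.NumberTheory.Transcendental.KZ.Equivalent r r'

/-- item stmt-KontsevichZagierPeriods-3598 · banked · rank 4 · closed · proved by Summit.KontsevichZagierPeriods.TerasomaMultiplication.MultiplicationThreeBolza.MultiplicationThree_proof (prover) · by planner
why it might fail: every printed proof leaves the algebraic class (Γ, e^{−t}, interpolation from integers); in the rules only N·([r]−[r′]) may be reachable if FormalRep/relations has torsion; a chain uniform in s may not exist even if each s has one.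
sources: Terasoma1995, OtsuboYamazaki2026, AndrewsAskeyRoy1999, Deligne1982HodgeCycles, KontsevichZagier2001
[crux] n = 3, all rational s > 0: [∫∫_{(0,1)²} v_1^{−2/3}(1−v_1)^{s−1} v_2^{−1/3}(1−v_2)^{s−1}] ~
[∫∫_{σ_1,σ_2>0, σ_1+σ_2<3} (σ_1σ_2(3−σ_1−σ_2))^{s−1}] (B(1/3,s)B(2/3,s) = 3^{3s−1}Γ(s)³/Γ(3s), e.g.
111.09287484 at s = 1/9). First non-real case of Terasoma's map (c_3 = i√3): exhibit Θ_3 ∈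
ℤ[(μ_d×μ_3)² ⋊ S_2] and a semialgebraic 3-chain W_3 ⊂ C²(ℂ) ⊂ ℝ⁸ with ∂W_3 = Z_0 − Θ_3·γ² (mod
chains on which (x_1x_2)^{a−d}(y_2−y_1)dy_1dy_2 restricts to 0), then Stokes = three Newton–Leibniz
moves with the form's coefficients as primitives, sheets as CoV, ζ_3-twists as (Re, Im) pairs.
[difficulty: L] -/
@[route_item "route-KontsevichZagierPeriods-MellinCoarea"]
def MultiplicationThree : Prop :=
  ∀ s : ℚ, 0 < s → ∀ (r r' : Literature.NumberTheory.Transcendental.KZ.IntegralRep 2), r.domain = {x | ∀ i, x i ∈ Set.Ioo (0:ℝ) 1} → Set.EqOn r.integrand (fun x => (x 0) ^ (-(2:ℝ)/3) * (1 - x 0) ^ ((s:ℝ) - 1) * (x 1) ^ (-(1:ℝ)/3) * (1 - x 1) ^ ((s:ℝ) - 1)) r.domain → r'.domain = {x | 0 < x 0 ∧ 0 < x 1 ∧ x 0 + x 1 < 3} → Set.EqOn r'.integrand (fun x => (x 0 * x 1 * (3 - x 0 - x 1)) ^ ((s:ℝ) - 1)) r'.domain → Literature.NumberTheory.Transcendental.KZ.Equivalent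 r r'

-- `MultiplicationThree` holds: proved by `Summit.KontsevichZagierPeriods.TerasomaMultiplication.MultiplicationThreeBolza.MultiplicationThree_proof` (its module imports this route file, so no `_holds` link can be stated here).

-- earlier SummitImpliesTransfer (stmt-KontsevichZagierPeriods-5086, replaced 2026-08-15T16:18:41Z -> stmt-KontsevichZagierPeriods-10575): retired by None — Literature.NumberTheory.Transcendental.KZPeriodConjecture' → ∀ ⦃b k : ℕ⦄ (r r' : Literature.NumberTheory.Transcendental.KZ.IntegralRep (b + k)), (∀ᵐ x : (Fin b → ℝ), (∫ y in {y : Fin k → ℝ | Fin.append x y ∈ r.domain}, r.integrand (Fin.append x y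
/-- item stmt-KontsevichZagierPeriods-10575 · support · rank 9 · closed · proved by Summit.KontsevichZagierPeriods.MellinCoarea.summitImpliesTransfer_proof @ 9150d29d733e (prover) · by planner
sources: KontsevichZagier2001, HuberMullerStach2017
[support] the summit itself implies FibrewiseTransfer, certifying that X is a REFORMULATION of
Conjecture 1, not a strengthening: given r, r′ of dimension b + k with a.e.-equal fibre integrals,
their values agree by Fubini along Fin.append (KZProduct.appendMeasurableEquiv is
volume-preserving); pass to KZ-rational equivalents (KZ.exists_isRational_equivalent_holds; values
kept by KZ.Equivalent.value_eq_holds), apply the summit, compose (Equivalent.trans/symm). Restated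
2026-08-15 over the summit decl instead of the open companion form KZPeriodConjecture′ (same
content, kzPeriodConjecture'_iff_isRational in tree) so that the route cone reaches no undeclared
conjecture. [difficulty: provable-now] -/
@[route_item "route-KontsevichZagierPeriods-MellinCoarea"]
def SummitImpliesTransfer : Prop :=
  KontsevichZagierPeriods → FibrewiseTransfer

-- `SummitImpliesTransfer` holds: proved by `Summit.KontsevichZagierPeriods.MellinCoarea.summitImpliesTransfer_proof` @ 9150d29d733e (its module imports this route file, so no `_holds` link can be stated here).

/-- item stmt-KontsevichZagierPeriods-3727 · support · rank 9 · closed · proved by Summit.KontsevichZagierPeriods.MellinCoarea.duplicationFamily_proof @ 1e174021b952 (prover) · by planner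
sources: KontsevichZagier2001, AndrewsAskeyRoy1999, Waldschmidt2006
[support] Legendre duplication in Beta form for every rational a > 0: [(0,1), (u(1−u))^{a−1}] ~
[(0,1), 2^{1−2a}·u^{-1/2}(1−u)^{a−1}] (three moves: split at u = 1/2, u ↦ 1−u, t = 4u(1−u));
stmt-0118 is the instance a = 1/3; the Assembly uses a = 1/18 and a = 5/18. [difficulty:
provable-now] -/
@[route_item "route-KontsevichZagierPeriods-MellinCoarea"]
def DuplicationFamily : Prop :=
  ∀ a : ℚ, 0 < a → ∀ (r r' : Literature.NumberTheory.Transcendental.KZ.IntegralRep 1), r.domain = {x | x 0 ∈ Set.Ioo (0:ℝ) 1} → Set.EqOn r.integrand (fun x => (x 0 * (1 - x 0)) ^ ((a:ℝ) - 1)) r.domain → r'.domain = {x | x 0 ∈ Set.Ioo (0:ℝ) 1} → Set.EqOn r'.integrand (fun x => (2:ℝ) ^ (1 - 2 * (a:ℝ)) * (x 0) ^ (-(1:ℝ)/2) * (1 - x 0) ^ ((a:ℝ) - 1)) r'.domain → Literature.NumberTheory.Transcendental.KZ.Equivalent r r'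

-- `DuplicationFamily` holds: proved by `Summit.KontsevichZagierPeriods.MellinCoarea.duplicationFamily_proof` @ 1e174021b952 (its module imports this route file, so no `_holds` link can be stated here).

/-- item stmt-KontsevichZagierPeriods-5084 · support · rank 9 · closed · proved by Summit.KontsevichZagierPeriods.MellinCoarea.coareaShear_proof @ 0214bbbce3cd (prover) · by planner
sources: KontsevichZagier2001, ArnoldGuseinzadeVarchenko2012, BochnakCosteRoy1998
[support] the coarea move is ONE instance of rule (2): for F ℚ-semialgebraic on r.domain ⊂ ℝ^{n+1}
with a derivative F′ within the domain and Φ(x) = (init x, F x) injective there, if r′.domain =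
Φ(r.domain) and r.integrand x = r′.integrand (Φ x)·|∂F/∂x_n(x)|, then [r] − [r′] ∈
changeOfVariablesRel (det Φ′ = ∂F/∂x_n, block-triangular). The same shear as
ScissorsTransport.NewtonLeibnizElimination with F the level function instead of the primitive; used
twice per side in TriplicationCoareaGlue. [difficulty: provable-now] -/
@[route_item "route-KontsevichZagierPeriods-MellinCoarea"]
def CoareaShear : Prop :=
  ∀ ⦃n : ℕ⦄ (r r' : Literature.NumberTheory.Transcendental.KZ.IntegralRep (n + 1)) (F : (Fin (n + 1) → ℝ) → ℝ) (F' : (Fin (n + 1) → ℝ) → (Fin (n + 1) → ℝ) →L[ℝ] ℝ), Literature.NumberTheory.Transcendental.IsSemialgebraicFunOn ℚ r.domain F → (∀ x ∈ r.domain, HasFDerivWithinAt F (F' x) r.domain x) → Set.InjOn (fun x => (Fin.snoc (Fin.init x) (F x) : Fin (n + 1) → ℝ)) r.domain → r'.domain = (fun x => (Fin.snoc (Fin.init x) (F x) : Fin (n + 1) → ℝ)) '' r.domain → (∀ x ∈ r.domain, r.integrand x = r'.integrand (Fin.snoc (Fin.init x) (F x)) * |F' x (Pi.single (Fin.last n)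 1)|) → Literature.NumberTheory.Transcendental.KZ.of r - Literature.NumberTheory.Transcendental.KZ.of r' ∈ Literature.NumberTheory.Transcendental.KZ.changeOfVariablesRel

-- `CoareaShear` holds: proved by `Summit.KontsevichZagierPeriods.MellinCoarea.coareaShear_proof` @ 0214bbbce3cd (its module imports this route file, so no `_holds` link can be stated here).

/-- item stmt-KontsevichZagierPeriods-5085 · support · rank 9 · open · by planner
sources: KontsevichZagier2001, ArnoldGuseinzadeVarchenko2012
[support] the fibred n = 3 statement and the box/simplex statement are equivalent inside the rules:
simplex side = domain additivity at σ₂ = (3−σ₁)/2 (null line) + CoareaShear on the two monotonicity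
cells of σ₂ ↦ σ₁σ₂(3−σ₁−σ₂) (both land on [Σ_simp, u^{s−1}/√(a²(3−a)²−4ua)]) + integrand additivity
(factor 2) + the coordinate swap (u first); box side = one CoareaShear along v₂ for (1−v₁)(1−v₂)
(|∂| = 1−v₁, image Σ_box) + swap. Radicals explicit; side conditions (InjOn, HasFDerivWithinAt,
semialgebraic images) routine. [difficulty: M] -/
@[route_item "route-KontsevichZagierPeriods-MellinCoarea"]
def TriplicationCoareaGlue : Prop :=
  TriplicationFibreTransfer ↔ MultiplicationThree

/-- item stmt-KontsevichZagierPeriods-5087 · assembly · rank 1 · closed · proved by Summit.KontsevichZagierPeriods.MellinCoarea.assembly_proof @ 0075ffca793d (prover) · by planner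
sources: KontsevichZagier2001, HuberMullerStach2017
[assembly] FibrewiseTransfer → KontsevichZagierPeriods (slab padding to a common dimension, b = 0,
Dirac a.e., transitivity). -/
@[route_item "route-KontsevichZagierPeriods-MellinCoarea"]
def Assembly : Prop :=
  FibrewiseTransfer → KontsevichZagierPeriods

-- `Assembly` holds: proved by `Summit.KontsevichZagierPeriods.MellinCoarea.assembly_proof` @ 0075ffca793d (its module imports this route file, so no `_holds` link can be stated here).

/-! D-0027 §2.1 — DECIDING THEOREM (planner-authored via `route open/edit --closes-file`; by planner-rbadge-KontsevichZagierPeriods-MellinC-285615bb-g2-0 2026-08-15T16:19:47Z):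
its hypotheses are this route's items and its conclusion the sub-problem Statement (glue_lint), and it elaborates with this file. -/

/-- Route glue (D-0027 §2.1). The target `FibrewiseTransfer` (Conjecture 1 in families) ALONE
decides the summit, by constant families (`b = 0`): given KZ-rational `r` (dimension `n`) and `r'`
(dimension `m`) with equal values, raise both to the common dimension `0 + max n m` by slabs
(`KZ.IntegralRep.exists_equivalent_of_le`; values are kept by soundness
`KZ.Equivalent.value_eq_holds`); over the one-point base `Fin 0 → ℝ` the fibre integral of a
representation is its value (`Fin.append x y = y ∘ Fin.cast _` is a volume-preserving relabelling
of coordinates, `MeasurableEquiv.piCongrLeft`), so the a.e. hypothesis of `FibrewiseTransfer` is the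
single equality of values; compose the three equivalences (`Equivalent.trans/symm`). This proves the
statement of the item `Assembly` (which a Theorems file may now close by `:= closes`). -/
@[closes "route-KontsevichZagierPeriods-MellinCoarea"] theorem closes (hT : FibrewiseTransfer) : KontsevichZagierPeriods := by
  intro n m r r' _ _ hv
  -- (1) over the trivial base `Fin 0 → ℝ`, the fibre integral of `R` is `R.value`
  have fibre : ∀ {k : ℕ} (R : Literature.NumberTheory.Transcendental.KZ.IntegralRep (0 + k))
      (x : Fin 0 → ℝ),
      ∫ y in {y : Fin k → ℝ | Fin.append x y ∈ R.domain}, R.integrand (Fin.append x y)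
        = R.value := by
    intro k R x
    let e : (Fin k → ℝ) ≃ᵐ (Fin (0 + k) → ℝ) :=
      (MeasurableEquiv.piCongrLeft (fun _ : Fin k => ℝ) (finCongr (Nat.zero_add k))).symm
    have he : MeasurePreserving e volume volume :=
      (volume_measurePreserving_piCongrLeft (fun _ : Fin k => ℝ)
        (finCongr (Nat.zero_add k))).symm _
    have happ : ∀ y : Fin k → ℝ, Fin.append x y = e y := by
      intro y
      rw [Fin.append_left_nil x y rfl]
      funext i
      rfl
    simp only [happ]
    exact he.setIntegral_preimage_emb e.measurableEmbedding R.integrand R.domain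
  -- (2) raise both representations to the common dimension `0 + max n m` (slabs)
  obtain ⟨R, hR⟩ := r.exists_equivalent_of_le (N := 0 + max n m)
    ((le_max_left n m).trans_eq (Nat.zero_add _).symm)
  obtain ⟨R', hR'⟩ := r'.exists_equivalent_of_le (N := 0 + max n m)
    ((le_max_right n m).trans_eq (Nat.zero_add _).symm)
  have h₁ : r.value = R.value :=
    Literature.NumberTheory.Transcendental.KZ.Equivalent.value_eq_holds hR
  have h₂ : r'.value = R'.value :=
    Literature.NumberTheory.Transcendental.KZ.Equivalent.value_eq_holds hR'
  have hvR : R.value = R'.value := h₁.symm.trans (hv.trans h₂)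
  -- (3) constant family over `Fin 0 → ℝ`: the a.e. hypothesis is the equality of values
  have key : Literature.NumberTheory.Transcendental.KZ.Equivalent R R' :=
    hT R R' (Filter.Eventually.of_forall fun x => by rw [fibre R x, fibre R' x, hvR])
  exact hR.trans (key.trans hR'.symm)

end Summit.KontsevichZagierPeriods.KontsevichZagierPeriods.Theses.MellinCoarea
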